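import Literature.AnabelianGeometry.EtaleTheta.ArithThetaTowerCarrierSpecOf
import Literature.AnabelianGeometry.EtaleTheta.ArithThetaTowerCarrier
import Literature.AnabelianGeometry.EtaleTheta.ArithThetaTowerRealified
import Literature.AnabelianGeometry.EtaleTheta.ArithThetaTowerDivisorsGeomDichotomy
import Literature.AnabelianGeometry.EtaleTheta.ArithThetaTowerIsFrobenioid
import HarnessLib

/-!
# [IUTchI] Ex. 3.2 (i) / [EtTh] Def. 3.6 (ii): THE tempered Frobenioid `ℱ̲_v̲` of the ARITHMETIC theta tower over `𝒟_v̲ = CosetCat Π_v̲`, its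
# decoupling spec S0 and its pull dichotomy (GAP A item GA-12, LAW half of D4 — file 3 of 3: the RULED decls)

S. Mochizuki, *The étale theta function …*, Publ. RIMS **45** (2009) [MochizukiEtTh2009], Def. 3.3 (iii) / Rmk. 3.3.1 p.73, Def. 3.6 (i)(ii)
pp.76–77, Prop. 1.4 (i) p.21, §5 p.104 [cite: MochizukiEtTh2009, Def 3.6 p.77]; *Inter-universal Teichmüller Theory I* [Mochizuki2012], Ex. 3.2
(i)(ii) pp.69–71 («the hyperbolic curve `X̲̲_v` determines a tempered Frobenioid `ℱ̲_v` over the base category `𝒟_v`», «`Ÿ_v`», «`Θ̲_v`»)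
[claim: Mochizuki2012, status: disputed — nothing of the series is asserted here]; [FrdI] Def. 1.1 (i)(ii) p.19; [FrdII] Ex. 1.1 (i) p.7.

GAP A of record G-L5-EX32I-1 (abc-iut cell; the UNDISPUTED construction around [IUTchIII] Cor. 3.12 of the [EtTh] Def. 3.6 tempered Frobenioid at
a bad place), item **GA-12** = D4 LAW half (GAP-SIZING-A.md 69de97346848d3e8 §2; chair's ruled shapes `plan/L5/GAP-A-SIGNATURES.md` v1
e3ccddf9b87597cf §0/§4 «GA-04b (prover)» — binders `(d) (T)` and the three result types VERBATIM; RULINGS #317 (2) / #319 (c1)–(c4) / #321/#322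
(c2′)(c3′) / #334 (2) / #336 (1) / #339 (1)(3) / #342 (B)(C)), seat abc-iut-gapA-12-def36iiLawsCarrierSpec (abc-iut-L2-t1 class, prover).
Shared binders (§0): `{p} [Fact p.Prime] (d : GaloisValDatum.{0} p) {P : Type} [Group P] [TopologicalSpace P] (T : BadLocalGroupDatum d.Gal P)`,
plus `[IsTopologicalGroup P]` — the instance the slot's `↥(B x hx).H ≤ D.PiC` (a `ProfiniteGrp`) carries (§6 typer's call, keeper-ENDORSED,
COUNTERSIGNED #342 (C): [FrdI] Def. 1.1 (ii)(b) rests on `CosetCat.isOfFSMType`).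

ONE RECIPE (#342 (B)), CONSUMED BY NAME: GA-02's ruled `divisorMonoids d T = divisorMonoidsOf d T (deckAction d T) (Envelope.cuspLaws (Cpt d T))`
(★ p671144; `deckAction d T = Envelope.action (Π ⧸ Π_Ÿ) Π`, GA-10 ★ p670709), GA-03's ruled `realified d T = ofRlfZWeak (divisorMonoids d T) _`
(★ p672371; definitionally `realifiedOf d T (deckAction d T) _`), GA-04's `catVocab`/`CarrierSpec`/`CarrierData` (★ p667989) and
`CarrierSpec.PullDichotomy` (★ p670531), this seat's engine `temperedFrobenioidOf` (★ p670142) with `carrierSpec_temperedFrobenioidOf` /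
`pullDichotomy_temperedFrobenioidOf` (★ p673368; GA-08's transport ★ p671252 inside), GA-10's theta section `thetaSectionSelf` / `thetaZerosΦ₀` /
`thetaPolesΦ₀` / `div₀_thetaSection_mul` (★ p670709) and orbit dichotomy `Envelope.phiZeroPull_dichotomy` (★ p672771).

WHAT IS HERE — the three RULED decls:
* **`temperedFrobenioid d T : TemperedFrobenioid (realified d T) T.Dv (catVocab d T)`** := the engine `temperedFrobenioidOf` at the decreed theta
  envelope with the deck action of `Π` (`= (CarrierData.canonical (realified d T)).toTemperedFrobenioid h₁ … h₅`, GA-04 ★ p667989 :223, with the five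
  [EtTh] Def. 3.6 (ii) laws CLOSED in file 1; `hZc := Envelope.model_const`, keeper π5);
* **`carrierSpec_temperedFrobenioid d T : CarrierSpec d T (temperedFrobenioid d T)`** — S0 HOLDS AT THE TERM (the item that makes GA-05/06/08's
  binders instantiate in GA-07): `theta` fed by the GENUINE geometric witness `envelope_thetaWitness Π_Ÿ` (GA-10's `thetaSectionSelf`
  `γ·Π_Ÿ ↦ Θ̈_{γ·Π_Ÿ}`, zeros = all cusps CUSPIDAL, poles = `[F_c]`-family NON-CUSPIDAL (decreed finite avatar of `D₁`, labelled), coprime,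
  `div θ·[Pl] = [Zr]`);
* **`pullDichotomy_temperedFrobenioid d T : CarrierSpec.PullDichotomy (temperedFrobenioid d T)`** — the seventh clause of S0 (RULINGS #339 (1)):
  on `Φ₀^geom(Π/U) = ℕ^{U-orbits of (C × Bool) ⊔ C}` the pull along `gU ↦ g·n·U` is `e_O ↦ e_{n·O}` — identity, or a `U`-orbit `O` with
  `n·O ⊄ O` whose primary `e_O` witnesses; identity on the `ord(Ω^{aug U})` coordinate (`valuation_gal_eq`); transported to `Φ(U) ≅ Φ₀(U)^pf` (file 2).

carrier: genuine-by-[EtTh]-recipe on the T-lattice (Ÿ_T, Ÿ_T × V, X̲̲_v̲ × V) + constants everywhere; off-lattice Φ via `rebase`/pullback; [EtTh] Def 3.3 Φ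
at general U and print's Ÿ̈/μ_N Kummer levels = FOUNDATIONS 13/14, not claimed (RULINGS #322 (c3′), label of record; the carrier is GA-02/GA-04's).
GUARD (#322): for a `T` that is not a finite level of the theta tower the carrier is print's recipe TRANSPORTED by (n_T, e(V|K_v̲)).  MODEL NOTE
(crit-A 21:42:59Z): the envelope is a LABELLED finite-level avatar — its cusp/component counts and the `Φ₀`-ranks of low objects are NOT print's
numbers for the curve, and nothing here reads them as such.

HONEST FRAMING: a construction and two theorems over OUR typed interfaces (`GaloisValDatum`/`BadLocalGroupDatum`, GA-10's DECREED finite-level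
envelope); `temperedFrobenioid d T` is the inhabitant of OUR spec S0, NOT print's tempered Frobenioid of an actual Tate curve and NOT a theorem
of print; an UNDISPUTED construction around [IUTchIII] Cor. 3.12, which stays OPEN by charter (D-0045) — no side is taken on it or on any author;
nothing here asserts the abc conjecture proved or refuted; typed ≠ inhabited-in-print ≠ proved-in-print ≠ tokened; COUNT-NEUTRAL until the chair
tokens the headline row.  No `Prop`-valued fact, no instance, no notation, no attribute manipulation, no `sorry`.
-/

noncomputable section

namespace Literature.AnabelianGeometry.EtaleTheta

namespace ArithThetaTower

open CategoryTheory Opposite Function Literature.AlgebraicGeometry.Frobenioids Literature.AnabelianGeometry.SemiGraphs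
  Literature.IUT.HodgeTheaters LogDivisorModel LogDivisorModel.GaloisAction

/-! ## §1 The geometric theta witness at the envelope (GA-10's theta section, zeros, poles) -/

section Witness

variable {P : Type} [Group P] [TopologicalSpace P] {C : Type} [MulAction P C]

/-- The polar family is non-trivial (its value at the base point is `[F_{c₀}] ≠ 0`). [cite: MochizukiEtTh2009, Prop 1.4 p.21] -/
theorem thetaPolesΦ₀_ne_one (Y : OpenSubgroup P) {c₀ : C} (hY : ∀ y ∈ Y, y • c₀ = c₀) : thetaPolesΦ₀ Y hY ≠ 1 := fun e => by
  have e1 : (thetaPolesΦ₀ Y hY).1 ((1 : P) : (cosetObj Y).carrier) = 1 :=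
    congrArg (fun ψ : (divisorsGeom P C).Φ₀.obj (op (cosetObj Y)) => ψ.1 ((1 : P) : (cosetObj Y).carrier)) e
  rw [thetaPolesΦ₀_apply_one] at e1
  exact Envelope.thetaPoles_ne_one c₀ (Subtype.ext e1)

/-- **The zero family and the polar family of the theta section are COPRIME in `Φ₀^geom(Γ/Y)`**: a common divisor is effective and bounded, at
every point and every prime log-divisor, by two multiplicities one of which vanishes (GA-10's `thetaZerosΦ₀_disjoint_thetaPolesΦ₀`), hence trivial.
[cite: MochizukiEtTh2009, Def 4.1 (i) p.86] -/
theorem isRelPrime_thetaZerosΦ₀_thetaPolesΦ₀ (Y : OpenSubgroup P) {c₀ : C} (hY : ∀ y ∈ Y, y • c₀ = c₀) :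
    IsRelPrime (thetaZerosΦ₀ C (cosetObj Y)) (thetaPolesΦ₀ Y hY) := by
  intro e hZ hP
  suffices he : e = 1 by
    rw [he]
    exact isUnit_one
  obtain ⟨c, hc⟩ := hZ
  obtain ⟨c', hc'⟩ := hP
  refine Subtype.ext (funext fun y => Multiplicative.toAdd.injective (funext fun x => ?_))
  have he0 : 0 ≤ Multiplicative.toAdd (e.1 y) x := (e.2.1 y).2 x
  have hc0 : 0 ≤ Multiplicative.toAdd (c.1 y) x := (c.2.1 y).2 x
  have hc0' : 0 ≤ Multiplicative.toAdd (c'.1 y) x := (c'.2.1 y).2 x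
  have e1 : Multiplicative.toAdd ((thetaZerosΦ₀ C (cosetObj Y)).1 y) x =
      Multiplicative.toAdd (e.1 y) x + Multiplicative.toAdd (c.1 y) x :=
    congrArg (fun ψ : (divisorsGeom P C).Φ₀.obj (op (cosetObj Y)) => Multiplicative.toAdd (ψ.1 y) x) hc
  have e2 : Multiplicative.toAdd ((thetaPolesΦ₀ Y hY).1 y) x =
      Multiplicative.toAdd (e.1 y) x + Multiplicative.toAdd (c'.1 y) x :=
    congrArg (fun ψ : (divisorsGeom P C).Φ₀.obj (op (cosetObj Y)) => Multiplicative.toAdd (ψ.1 y) x) hc'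
  change Multiplicative.toAdd (e.1 y) x = 0
  rcases thetaZerosΦ₀_disjoint_thetaPolesΦ₀ Y hY y x with h0 | h0
  · rw [h0] at e1
    omega
  · rw [h0] at e2
    omega

/-- **THE GEOMETRIC THETA WITNESS AT THE ENVELOPE** (`C := Π/Y` its own cosets as components — ONE RECIPE, RULINGS #342 (B)): GA-10's theta section
`θ := thetaSectionSelf Y` (`γ·Y ↦ Θ̈_{γ·Y}`) with its CUSPIDAL zero family `Zr` (all cusps, multiplicity 1 — print, [EtTh] Prop. 1.4 (i)) and NON-CUSPIDAL
polar family `Pl` (`γ·Y ↦ [F_{γ·Y}]` — the DECREED finite-level avatar of `D₁`, labelled, [EtTh] Rmk. 1.3.1), both non-trivial, coprime, with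
`div θ · [Pl] = [Zr]` (`div₀_thetaSection_mul`).  This is the `hθ` binder of `carrierSpec_temperedFrobenioidOf` at `Y := Π_Ÿ`.
[cite: MochizukiEtTh2009, §5 p.104] -/
theorem envelope_thetaWitness (Y : OpenSubgroup P) :
    ∃ (θ : (Envelope.action (P ⧸ Y.toSubgroup) P).bZero (Action.ofMulAction P (P ⧸ Y.toSubgroup)))
      (Zr Pl : (Envelope.action (P ⧸ Y.toSubgroup) P).phiZero (Action.ofMulAction P (P ⧸ Y.toSubgroup))),
      Zr ∈ (Envelope.action (P ⧸ Y.toSubgroup) P).cspZero _ ∧ Pl ∈ (Envelope.action (P ⧸ Y.toSubgroup) P).ncspZero _ ∧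
        Zr ≠ 1 ∧ Pl ≠ 1 ∧ IsRelPrime Zr Pl ∧
        (Envelope.action (P ⧸ Y.toSubgroup) P).divZeroHom _ θ * Algebra.GrothendieckGroup.of Pl = Algebra.GrothendieckGroup.of Zr :=
  ⟨thetaSectionSelf Y, thetaZerosΦ₀ (P ⧸ Y.toSubgroup) (cosetObj Y), thetaPolesΦ₀ Y (smul_base_eq_of_mem Y),
    thetaZerosΦ₀_mem_csp₀ (cosetObj Y), thetaPolesΦ₀_mem_ncsp₀ Y (smul_base_eq_of_mem Y), thetaZerosΦ₀_ne_one (cosetObj Y),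
    thetaPolesΦ₀_ne_one Y (smul_base_eq_of_mem Y), isRelPrime_thetaZerosΦ₀_thetaPolesΦ₀ Y (smul_base_eq_of_mem Y),
    div₀_thetaSection_mul Y (smul_base_eq_of_mem Y)⟩

end Witness

/-! ## §2 THE RULED DECLS -/

variable {p : ℕ} [Fact p.Prime] (d : GaloisValDatum.{0} p) {P : Type} [Group P] [TopologicalSpace P] [IsTopologicalGroup P]
  (T : BadLocalGroupDatum d.Gal P)

/-- **[IUTchI] Ex. 3.2 (i) / [EtTh] Def. 3.6 (ii): THE tempered Frobenioid `ℱ̲_v̲` of the arithmetic theta tower over `𝒟_v̲ = CosetCat Π_v̲`** (GAP A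
row D4, RULED): structure functor `𝟭 𝒟_v̲`; divisor monoid GA-04's carrier datum `Φ(U) = perfSaturation(im(Φ₀(U) → Φ₀^ℝ(U)))` over GA-03's
`realified d T` — GENUINE constants `(Ω^{aug U})ˣ`/`ord(𝒪^▷_{Ω^{aug U}})` at EVERY `U` through `T.proj` × GA-10's decreed theta envelope of the
fibre `Π ⧸ Π_Ÿ` with the deck action of `Π` (ONE RECIPE, #342 (B)); the five Def. 3.6 (ii) laws CLOSED (file 1, engine `ofGenDiagonalBase`), assembled by
GA-04's `CarrierData.toTemperedFrobenioid` (★ p667989 :223) — `:= temperedFrobenioidOf d T (deckAction d T) (Envelope.cuspLaws _) (Envelope.model_const _)`.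
carrier: genuine-by-[EtTh]-recipe on the T-lattice (Ÿ_T, Ÿ_T × V, X̲̲_v̲ × V) + constants everywhere; off-lattice Φ via `rebase`/pullback; [EtTh]
Def 3.3 Φ at general U and print's Ÿ̈/μ_N Kummer levels = FOUNDATIONS 13/14, not claimed.  GUARD (#322): for a `T` that is not a finite level of
the theta tower the carrier is print's recipe TRANSPORTED by (n_T, e(V|K_v̲)).  TYPED inhabitant of OUR spec — NOT print's `ℱ̲_v̲` of an actual Tate
curve; no side on [IUTchIII] Cor. 3.12; NOT an abc claim. [cite: MochizukiEtTh2009, Def 3.6 p.77] -/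
def temperedFrobenioid : TemperedFrobenioid (realified d T) T.Dv (catVocab d T) :=
  temperedFrobenioidOf d T (deckAction d T) (Envelope.cuspLaws (Cpt d T)) (Envelope.model_const (Cpt d T))

/-- The ruled decl IS the engine at the envelope (by definition). [cite: MochizukiEtTh2009, Def 3.6 p.77] -/
theorem temperedFrobenioid_eq :
    temperedFrobenioid d T = temperedFrobenioidOf d T (deckAction d T) (Envelope.cuspLaws (Cpt d T)) (Envelope.model_const (Cpt d T)) := rfl

/-- Its structure functor is the identity of `𝒟_v̲`. [cite: MochizukiEtTh2009, Def 3.6 p.77] -/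
theorem temperedFrobenioid_base : (temperedFrobenioid d T).base = 𝟭 T.Dv := rfl

/-- Its divisor monoid is GA-04's carrier datum of record at GA-03's `realified d T`. [cite: MochizukiEtTh2009, Def 3.6 p.77] -/
theorem temperedFrobenioid_Φ : (temperedFrobenioid d T).Φ = (CarrierData.canonical (realified d T) (d := d) (T := T)).Φ := rfl

/-- Its monoid type is `ℤ`. [cite: MochizukiEtTh2009, Def 3.6 p.77] -/
theorem temperedFrobenioid_monoidType : (temperedFrobenioid d T).monoidType = MonoidType.Z := rfl

/-- **`temperedFrobenioid d T` IS a Frobenioid** ([FrdI] Def. 1.3 via Thm. 5.2 (ii)) — GA-05's HYPOTHESIS-FREE `isFrobenioid_realifiedOf`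
(★ p669819) at the term, BY NAME; the `hF` binder of GA-06/GA-16's `thetaRestBirat_of_carrierSpec` and of GA-07's knit at this carrier.
[cite: MochizukiFrdI2008, Thm. 5.2 (ii) p.100] -/
theorem isFrobenioid_temperedFrobenioid : PreFrobenioid.IsFrobenioid (temperedFrobenioid d T).toElem :=
  isFrobenioid_realifiedOf d T (deckAction d T) (Envelope.cuspLaws (Cpt d T)) (temperedFrobenioid d T)

/-- **S0 `CarrierSpec d T` HOLDS AT THE TERM `temperedFrobenioid d T`** (GAP A row D4, RULED; the item that makes GA-05/06/08's binders instantiate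
in GA-07): `base_eq`/`Φ_carrier` by `rfl`; `consts` = the GENUINE constant tower through `T.proj` embedded as `(u, 1)`/`(x, 1)` (#334 (2)(b));
`aut_finite`/`lZ` by GA-04's dischargers; `theta` by the geometric witness `envelope_thetaWitness Π_Ÿ` (GA-10's theta section on `Ÿ_T = Π/Π_Ÿ`).
TYPED ≠ proved-in-print; no side on [IUTchIII] Cor. 3.12; NOT an abc claim. [cite: MochizukiEtTh2009, Def 3.6 p.77] -/
theorem carrierSpec_temperedFrobenioid : CarrierSpec d T (temperedFrobenioid d T) :=
  carrierSpec_temperedFrobenioidOf d T (deckAction d T) (Envelope.cuspLaws (Cpt d T)) (Envelope.model_const (Cpt d T))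
    (envelope_thetaWitness T.Y)

/-- **The seventh clause of S0 — the pull dichotomy — HOLDS AT THE TERM** (RULINGS #339 (1)/(3); the `hD` binder of GA-08's
`isNonDilating_of_carrierSpec hC hD`, so H+ at EVERY object, binder-free): on `Φ₀^geom(Π/U) = ℕ^{U-orbits of (C × Bool) ⊔ C}` the pull along
`gU ↦ g·n·U` is `e_O ↦ e_{n·O}` — identity when every `U`-orbit is `n`-stable, else a `U`-orbit `O` with `n·O ⊄ O` whose primary `e_O` witnesses
(GA-10's `Envelope.phiZeroPull_dichotomy`); identity on the `ord(Ω^{aug U})` coordinate (`valuation_gal_eq`, file 2); transported to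
`Φ(U) ≅ Φ₀(U)^pf` by GA-08's `CarrierSpec.pullDichotomy_of_lattice` (ONE transport, keeper π4).  TYPED ≠ proved-in-print; no side on [IUTchIII]
Cor. 3.12; NOT an abc claim. [cite: MochizukiFrdI2008, Def. 1.1 (i) p.19] -/
theorem pullDichotomy_temperedFrobenioid : CarrierSpec.PullDichotomy (temperedFrobenioid d T) :=
  pullDichotomy_temperedFrobenioidOf d T (deckAction d T) (Envelope.cuspLaws (Cpt d T)) (Envelope.model_const (Cpt d T))
    (carrierSpec_temperedFrobenioid d T) fun U f =>
      Envelope.phiZeroPull_dichotomy (isConnectedGSet_cosetGSetFunctor_obj P U) ((cosetGSetFunctor P).map f)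

end ArithThetaTower

end Literature.AnabelianGeometry.EtaleTheta

end
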